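import Summits.BirchSwinnertonDyer.Rank1Residual.X11b.BDPRouteErratumData
import Summits.BirchSwinnertonDyer.Rank1Residual.X11b.AnticyclotomicModuleFinite
import Literature.NumberTheory.EllipticCurves.IwasawaAlgebraRankOneIdealProofs
import Mathlib.RingTheory.Nakayama
import HarnessLib

/-!
# Route `ErratumRoadFive`, crux `IMCDivAtErratumDataAll` (item stmt-BirchSwinnertonDyer-19270, H3♭),
# stub S2 `stub_imcDivErratum_splitAtP`: ROAD G — the GENERATOR (Λ-primitive Heegner class) road to the
# divisibility conjunct, as module theory; the END FORM against the real `X_ac^∅`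
# (cell `bsd-stepL`, PART 1b ACCEL seat `bsd-stepL-imc24b` g2; `--supports stmt-BirchSwinnertonDyer-19270`, helper; Theses-free)

THEOREMS ONLY (no definition, no named fact, no `sorry`); nothing about the anticyclotomic main
conjecture, about Heegner classes or about BSD is asserted: the three cohomological inputs of the road
are HYPOTHESES on abstract `Λ`-modules, exactly as in the tree's Kato skeleton files
(`Literature.…KatoDivisibilitySkeletonProofs`, `…Kato2004.MainConjectureSkeletonProofs`).

## The road (second reading of the seat's row «bipartite Euler system one-divisibility at split `p`»)

The crux conjunct `Ch_Λ(X_ac^∅(E[p^∞]))·𝓞_{ℂ_p}⟦T⟧ ⊆ (Q)` is erratum (2.4), the LOWER bound on the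
BDP Selmer group; Euler∕Kolyvagin∕bipartite systems give the other inclusion (seat g0's direction
audit, evidence #13 on the item). But the two inclusions are not independent of the Heegner side:
by Castella's Poitou–Tate bookkeeping — F. Castella, *`p`-adic heights of Heegner points and
Beilinson–Flach classes*, J. Lond. Math. Soc. 96 (2017), Appendix A, **Lemma A.3** («for any height
one prime `P` of `Λ_{R₀}`: `ord_P(L_𝔭^{BDP}) = length_P(coker(loc_𝔭)Λ_{R₀}) + length_P(Sel(K,𝐓)Λ_{R₀}
∕Λ_{R₀}·𝐳_f)`») and **Lemma A.4** («`length_P(X_{∅,0}) = length_P(X_tors) + 2·length_P(coker(loc_𝔭))`»,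
from the global-duality sequence **(A.7)** `0 → coker(loc_𝔭^∅) → X_{∅,0} → X_{Gr,0} → 0`), reproduced
verbatim in Burungale–Castella–Kim, *A proof of Perrin-Riou's Heegner point main conjecture*, Algebra
Number Theory 15 (2021), proof of Thm. 4.1 («a one-sided divisibility in Conjecture 1.1 holds if and
only if the same divisibility holds in Conjecture 1.2 … and similarly for the opposite
inequalities») — the crux inequality `length_𝔓(X_ac^∅) ≥ ord_𝔓(Q)` is EQUIVALENT, prime by prime,
to `length_𝔓(X_tors) ≥ 2·length_𝔓(𝔖_p ∕ Λκ_∞^*)`, hence AUTOMATIC at every height-one `𝔓` outside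
`supp(𝔖_p ∕ Λκ_∞^*)`, and it holds IN FULL at every datum where the `Λ`-adic Heegner class `κ_∞^*`
GENERATES the compact Selmer module `𝔖_p` — with no Eisenstein-congruence input at all. At `p ∥ N`
the two ingredients are: the explicit reciprocity law F. Castella, *Exceptional zeros for Heegner
points and `p`-converse …*, arXiv:2409.01360 (PREPRINT), Thm. 2.2 (split `p`: a `Λ`-linear
ISOMORPHISM `𝓛̃_𝔭 : H¹(K_𝔭, 𝔉⁺𝐓) ⊗̂ R₀ ≅ Λ_{R₀}` with `𝓛̃_𝔭(loc_𝔭(κ'_∞)) = L_𝔭(f)` up to a unit,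
`κ'_∞` the DERIVED class `κ_∞ = (γ − 1)κ'_∞` of the exceptional-zero formula Thm. 2.1) ∕ Cor. 2.3
(non-split `p`, `κ_∞` itself), and the generator condition, which by Nakayama (§1 below) is the
BOTTOM-LAYER statement «`pr₀(κ_∞^*)` generates `pr₀(𝔖_p) ⊆ Sel(K, T_pE) ≅ ℤ_p`», i.e.
`p ∤ [E(K) ⊗ ℤ_p : ℤ_p·y_K]` (times, at split `p`, the anticyclotomic `𝓛`-invariant of Thm. 2.1)
given the control `ker pr₀ ⊆ 𝔪𝔖_p`. This is STRICTLY WIDER than imc-p1's unit road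
(`P2.imcDivIntCoreFrameAtDatum_of_thm32_of_unitValue`, p448996: `Q` a unit ⟺ `y_K ∉ pE(K_𝔭)`,
LOCAL indivisibility): pairs with `ord_p log_ω(g_E) ≥ 2` (e.g. imc-p1's 5835a1 at 5) have NO unit
datum at any field but generator data at every field with `p ∤ [E(K):ℤy_K]`. HONEST MASS: like the
unit road, ROAD G never reaches a datum with `p ∣ [E(K):ℤy_K]` — which is where (2.4) has content
(there `X_ac^∅ ⊋` the Heegner part) and where the residual pairs of LADDER K2 live; it is a
WITNESS∕STRUCTURE road (BC5), and it LOCATES the content of the crux: (2.4) ⟺ the `Λ`-adic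
Kolyvagin-STRUCTURE lower bound `length_𝔓(X_tors) ≥ 2·length_𝔓(𝔖_p∕Λκ_∞^*)` on `supp(𝔖_p∕Λκ_∞^*)`.

## What is proved (module theory; `R` a Noetherian factorial domain, e.g. `Λ = ℤ_p⟦T⟧`)

* §1 `GeneratorRoad.span_singleton_eq_top_of_range_le_span` — NAKAYAMA GENERATOR CRITERION: `S`
  finitely generated over a local ring, `pr : S → M` linear with `ker pr ⊆ 𝔪S`, `pr(S) ⊆ R·pr z` ⟹
  `S = R·z` («`κ_∞^*` generates `𝔖_p` iff its bottom layer generates `pr₀(𝔖_p)`»).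
* §1 `GeneratorRoad.charIdeal_le_span_singleton_of_injective` — `R ⧸ (a) ↪ X` (`X` f.g. torsion)
  ⟹ `char_R(X) ⊆ (a)` (multiplicativity of `char` in `0 → R∕(a) → X → X∕(R∕(a)) → 0`, tree theorems
  `Module.charIdeal_eq_mul_of_exact`, `Module.charIdeal_quotient_span_singleton`; `a ≠ 0` is forced);
  `GeneratorRoad.map_charIdeal_le_span_of_injective` — the same read in an `R`-algebra `R'` through
  units: `φ(a)·w = u·Q`, `w, u ∈ R'ˣ` ⟹ `char_R(X)·R' ⊆ (Q)`.
* §2 `GeneratorRoad.charIdeal_map_le_span_of_generatorSkeleton` — **ROAD G END FORM** over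
  `Λ = IwasawaAlgebra p`: data `loc : S → P` (`𝔖_p → H¹(K_v, 𝔉⁺𝐓)` at the relaxed prime),
  `e : P ≃ Λ` (free of rank one: Cas24 Thm. 2.2 ∕ Cor. 2.3 + faithfully flat descent along
  `Λ → Λ_{R₀}`), (PT) `P ∕ loc(S) ↪ X` [JLMS17 (A.7)], (GEN) `S = Λ·z`, (ERL) `φ(e(loc z))·w = u·Q`
  ⟹ `char_Λ(X)·Λ' ⊆ (Q)`; and `…_of_nakayama` with (GEN) replaced by its bottom-layer form.
* §3 `P2.imcDivIntCoreFrameAtDatum_of_generatorSkeleton` — AT THE TREE'S MODULE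
  `X = AcSelmer.XAc (E_K) p κ 𝔭 ∅ γ` (f.g. by `XAc.module_finite_empty`, torsion by hypothesis — a tree
  theorem at erratum data, `controlUpperOnTreeAt_of_isErratumField`): the `∃`-body of
  `P2.IMCDivIntCoreFrameAtErratumData W p` AT A DATUM from a printed frame `(Ω_K, Ω_p, Q)` + the
  skeleton for that `Q`; `…AtErratumData_of_forall_generatorSkeleton` — the ∀-data shape (hence S2's
  and S1's conclusions) under the ∀-data skeleton hypothesis, recorded for completeness only (it is
  UNREALISTIC class-wide: divisible data exist).

References (locators only): [cite: Castella2018Erratum, (2.4), Thm. 1.1 (pp. 1, 4)];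
[cite: Castella2018, Def. 2.2, Thm. 3.1 (arXiv:1704.06608 pp. 5, 9)]; Castella JLMS 96 (2017) App. A
Lemmas A.2–A.4, (A.7) (arXiv:1509.02761 pp. 18–20); Burungale–Castella–Kim ANT 15 (2021) Thm. 4.1
(arXiv:1908.09512 p. 9); Castella arXiv:2409.01360 Thms. 2.1, 2.2, Cor. 2.3, Prop. 3.2 (pp. 5–9,
PREPRINT); Washington GTM 83 §13.2; Bourbaki AC VII §4.5 Prop. 10; Matsumura Thm. 2.2 (Nakayama).
-/

noncomputable section

open scoped Classical

open WeierstrassCurve NumberField IsDedekindDomain Field PowerSeries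
open Literature.NumberTheory.EllipticCurves Literature.NumberTheory.EllipticCurves.GreenbergSelmer
open Literature.NumberTheory.EllipticCurves.ModularForms
open Literature.NumberTheory.EllipticCurves.Rank1Residual
open Literature.NumberTheory.EllipticCurves.Rank1Residual.Typed
open Literature.NumberTheory.EllipticCurves.Castella2018
open Literature.NumberTheory.GaloisRepresentations
open Literature.NumberTheory.GaloisCohomology
open Summit.BirchSwinnertonDyer.Rank1Residual.X11b.AcSelmer
open Summit.BirchSwinnertonDyer.Rank1Residual.X11b.Halves

namespace Summit.BirchSwinnertonDyer.Rank1Residual.X11b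

/-! ### §1 Generic module theory: the Nakayama generator criterion and `R⧸(a) ↪ X ⟹ char X ⊆ (a)` -/

namespace GeneratorRoad

open Literature.NumberTheory.EllipticCurves.Module

section Nakayama

variable {R : Type*} [CommRing R] [IsLocalRing R] {S M : Type*} [AddCommGroup S] [Module R S]
  [AddCommGroup M] [Module R M]

/-- **Nakayama generator criterion** («the `Λ`-adic class generates the compact Selmer module iff its
bottom layer generates the bottom layer»). Let `R` be local, `S` a finitely generated `R`-module,
`pr : S → M` linear with `ker pr ⊆ 𝔪·S` (for `𝔖_p → Sel(K,T)`: `ker pr₀ = (γ − 1)𝔖_p`, control), and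
`z ∈ S` whose image generates the image of `pr` (for `Sel(K, T_pE) ≅ ℤ_p`: `pr₀(κ_∞^*)` is
`p`-indivisible). Then `z` generates `S`: indeed `S ⊆ R·z + ker pr ⊆ R·z + 𝔪S`, and Nakayama.
[cite: Washington1997, §13.2 (Nakayama's lemma for `Λ`-modules)] -/
theorem span_singleton_eq_top_of_range_le_span [Module.Finite R S] (pr : S →ₗ[R] M)
    (hker : LinearMap.ker pr ≤ (IsLocalRing.maximalIdeal R) • (⊤ : Submodule R S)) (z : S)
    (hz : LinearMap.range pr ≤ Submodule.span R {pr z}) : Submodule.span R {z} = ⊤ := by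
  refine top_le_iff.mp (Submodule.le_of_le_smul_of_le_jacobson_bot Module.Finite.fg_top
    (IsLocalRing.maximalIdeal_le_jacobson ⊥) fun s _ => ?_)
  obtain ⟨r, hr⟩ := Submodule.mem_span_singleton.mp (hz (LinearMap.mem_range_self pr s))
  have hmem : s - r • z ∈ LinearMap.ker pr := by
    rw [LinearMap.mem_ker, map_sub, map_smul, hr, sub_self]
  have hs : s = r • z + (s - r • z) := by abel
  rw [hs]
  exact Submodule.add_mem_sup (Submodule.smul_mem _ r (Submodule.mem_span_singleton_self z))
    (hker hmem)

/-- The generator criterion with the control hypothesis in its printed form `ker pr = T·S` for an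
element `T ∈ 𝔪` (for `Λ = ℤ_p⟦T⟧`, `T ↔ γ − 1`: «`𝔖_p ∕ (γ − 1)𝔖_p ↪ Sel(K, T)`»).
[cite: Washington1997, §13.2] -/
theorem span_singleton_eq_top_of_ker_eq_smul [Module.Finite R S] (pr : S →ₗ[R] M) {T : R}
    (hT : T ∈ IsLocalRing.maximalIdeal R)
    (hker : LinearMap.ker pr ≤ (Ideal.span {T}) • (⊤ : Submodule R S)) (z : S)
    (hz : LinearMap.range pr ≤ Submodule.span R {pr z}) : Submodule.span R {z} = ⊤ :=
  span_singleton_eq_top_of_range_le_span pr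
    (hker.trans (Submodule.smul_mono_left ((Ideal.span_singleton_le_iff_mem _).mpr hT))) z hz

end Nakayama

section CharIdeal

variable {R : Type*} [CommRing R] [IsDomain R] {X : Type*} [AddCommGroup X] [Module R X]

/-- If a torsion module `X` receives an injection from `R ⧸ (a)`, then `a ≠ 0` (else `R ↪ X` and the
image of `1` is not torsion). [folklore] -/
theorem ne_zero_of_injective_of_isTorsion (hX : Module.IsTorsion R X) {a : R}
    (ι : (R ⧸ Ideal.span {a}) →ₗ[R] X) (hι : Function.Injective ι) : a ≠ 0 := by
  rintro rfl
  obtain ⟨⟨r, hr⟩, hrx⟩ := @hX (ι (Ideal.Quotient.mk (Ideal.span {(0 : R)}) 1))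
  have h1 : ι (Ideal.Quotient.mk (Ideal.span {(0 : R)}) r) = 0 := by
    have : (Ideal.Quotient.mk (Ideal.span {(0 : R)}) r) =
        r • (Ideal.Quotient.mk (Ideal.span {(0 : R)}) 1) := by
      rw [map_one, ← Algebra.algebraMap_eq_smul_one, Ideal.Quotient.algebraMap_eq]
    rw [this, map_smul]
    exact hrx
  have h2 : Ideal.Quotient.mk (Ideal.span {(0 : R)}) r = 0 := hι (by rw [h1, map_zero])
  rw [Ideal.Quotient.eq_zero_iff_mem, Ideal.span_singleton_zero, Ideal.mem_bot] at h2
  exact nonZeroDivisors.ne_zero hr h2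

variable [IsNoetherianRing R] [UniqueFactorizationMonoid R] [Module.Finite R X]

/-- **`R ⧸ (a) ↪ X` ⟹ `char_R(X) ⊆ (a)`** for a finitely generated torsion module `X` over a
Noetherian factorial domain: `char(X) = char(R⧸(a))·char(X ⧸ R⧸(a)) = (a)·char(…) ⊆ (a)`
(multiplicativity of `char`, Bourbaki AC VII §4.5 Prop. 10, and `char(R⧸(a)) = (a)`, Washington
§13.2 — tree theorems). The algebra of «(A.7) + `coker(loc) = H¹∕Λ·loc(κ)` ⟹ lower bound».
[cite: Washington1997, §13.2] [cite: BourbakiAC5to7, Ch. VII §4 no. 5, Prop. 10] -/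
theorem charIdeal_le_span_singleton_of_injective (hX : Module.IsTorsion R X) {a : R}
    (ι : (R ⧸ Ideal.span {a}) →ₗ[R] X) (hι : Function.Injective ι) :
    charIdeal R X ≤ Ideal.span {a} := by
  have ha : a ≠ 0 := ne_zero_of_injective_of_isTorsion hX ι hι
  rw [charIdeal_eq_mul_of_exact hX ι (LinearMap.range ι).mkQ hι (Submodule.mkQ_surjective _)
    (LinearMap.exact_map_mkQ_range ι), charIdeal_quotient_span_singleton ha]
  exact Ideal.mul_le_right

/-- **… read in an `R`-algebra through units**: if moreover `φ : R → R'` and `φ(a)·w = u·Q` with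
`w, u` units of `R'` (the explicit reciprocity law: `w` = the image of the `Λ`-basis vector of
`H¹(K_v, 𝔉⁺𝐓)` under Castella's isomorphism `𝓛̃`, `u` = its «up to a `p`-adic unit»), then
`char_R(X)·R' ⊆ (Q)`. [cite: Washington1997, §13.2] -/
theorem map_charIdeal_le_span_of_injective {R' : Type*} [CommRing R'] (φ : R →+* R')
    (hX : Module.IsTorsion R X) {a : R} (ι : (R ⧸ Ideal.span {a}) →ₗ[R] X)
    (hι : Function.Injective ι) {w u Q : R'} (hw : IsUnit w) (hu : IsUnit u)
    (hQ : φ a * w = u * Q) : (charIdeal R X).map φ ≤ Ideal.span {Q} := by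
  have h1 : (charIdeal R X).map φ ≤ (Ideal.span {a}).map φ :=
    Ideal.map_mono (charIdeal_le_span_singleton_of_injective hX ι hι)
  rw [Ideal.map_span, Set.image_singleton] at h1
  have h2 : Ideal.span {φ a} = Ideal.span {Q} := by
    rw [← Ideal.span_singleton_mul_right_unit hw, hQ, Ideal.span_singleton_mul_left_unit hu]
  rwa [h2] at h1

end CharIdeal

/-! ### §2 ROAD G END FORM over `Λ = ℤ_p⟦T⟧` -/

section EndForm

variable {p : ℕ} [Fact p.Prime] {Λ' : Type*} [CommRing Λ'] (φ : IwasawaAlgebra p →+* Λ')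
  {X : Type*} [AddCommGroup X] [Module (IwasawaAlgebra p) X]
  {S P : Type*} [AddCommGroup S] [Module (IwasawaAlgebra p) S] [AddCommGroup P]
  [Module (IwasawaAlgebra p) P]

/-- The cokernel of `loc` restricted to a cyclic `S = Λ·z`, read through a trivialisation
`e : P ≃ Λ`, is `Λ ⧸ (e(loc z))`. [folklore] -/
theorem exists_linearEquiv_quotient_range_of_span_eq_top (loc : S →ₗ[IwasawaAlgebra p] P)
    (z : S) (e : P ≃ₗ[IwasawaAlgebra p] IwasawaAlgebra p)
    (hgen : Submodule.span (IwasawaAlgebra p) {z} = ⊤) :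
    Nonempty ((P ⧸ LinearMap.range loc) ≃ₗ[IwasawaAlgebra p]
      (IwasawaAlgebra p ⧸ Ideal.span {e (loc z)})) := by
  refine ⟨Submodule.Quotient.equiv _ _ e ?_⟩
  rw [LinearMap.range_eq_map, ← hgen, Submodule.map_span, Submodule.map_span, Set.image_singleton,
    Set.image_singleton]
  rfl

/-- **ROAD G END FORM.** Over `Λ = ℤ_p⟦T⟧`, let `X` be a finitely generated torsion `Λ`-module
(`X_ac^∅(E[p^∞])`), `loc : S → P` linear (`𝔖_p → H¹(K_v, 𝔉⁺𝐓)` at the relaxed prime `v` of `X`),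
`e : P ≃ Λ` (FREE OF RANK ONE: `H¹(K_v, 𝔉⁺𝐓)` is torsion-free — `H⁰(K_{∞,v}, 𝔉⁺T) = 0` — and
`⊗̂ R₀`-isomorphic to `Λ_{R₀}` by Cas24 Thm. 2.2 ∕ Cor. 2.3; descent along the faithfully flat
`Λ → Λ_{R₀}`), and assume: **(PT)** an injection `P ∕ loc(S) ↪ X` (global duality, JLMS17 (A.7)
`0 → coker(loc) → X_{∅,0} → X_{Gr,0} → 0`, read at the tree's `Sel_𝔭` through complex conjugation);
**(GEN)** `S = Λ·z` (`κ_∞^*` generates `𝔖_p`); **(ERL)** `φ(e(loc z))·w = u·Q` with units `w, u`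
of `Λ'` (Cas24 Thm. 2.2 ∕ Cor. 2.3: `𝓛̃(loc κ_∞^*) = L_𝔭(f)·unit`, `w = 𝓛̃(basis)`). THEN
`char_Λ(X)·Λ' ⊆ (Q)` — the divisibility conjunct of erratum (2.4) for this `Q`. Module theory only;
nothing is asserted about the objects. [cite: Castella2018Erratum, (2.4) (p. 4)]
[cite: Washington1997, §13.2] -/
theorem charIdeal_map_le_span_of_generatorSkeleton [Module.Finite (IwasawaAlgebra p) X]
    (hX : Module.IsTorsion (IwasawaAlgebra p) X) (loc : S →ₗ[IwasawaAlgebra p] P) (z : S)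
    (e : P ≃ₗ[IwasawaAlgebra p] IwasawaAlgebra p)
    (ι : (P ⧸ LinearMap.range loc) →ₗ[IwasawaAlgebra p] X) (hι : Function.Injective ι)
    (hgen : Submodule.span (IwasawaAlgebra p) {z} = ⊤)
    {w u Q : Λ'} (hw : IsUnit w) (hu : IsUnit u) (hERL : φ (e (loc z)) * w = u * Q) :
    (Literature.NumberTheory.EllipticCurves.Module.charIdeal (IwasawaAlgebra p) X).map φ ≤
      Ideal.span {Q} := by
  obtain ⟨ε⟩ := exists_linearEquiv_quotient_range_of_span_eq_top loc z e hgen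
  exact map_charIdeal_le_span_of_injective φ hX (ι ∘ₗ (ε.symm : _ →ₗ[IwasawaAlgebra p] _))
    (hι.comp ε.symm.injective) hw hu hERL

/-- **ROAD G END FORM, bottom-layer generator condition.** As
`charIdeal_map_le_span_of_generatorSkeleton`, with (GEN) replaced by its Nakayama form: `S` finitely
generated, `pr : S → M₀` (`pr₀ : 𝔖_p → Sel(K, T_pE)`) with `ker pr ⊆ 𝔪_Λ·S` (control) and
`pr(S) ⊆ Λ·pr(z)` («`pr₀(κ_∞^*)` generates»: for `Sel(K,T_pE) ≅ ℤ_p` this is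
`p ∤ [E(K)⊗ℤ_p : ℤ_p·pr₀(κ_∞^*)]`, i.e. `p ∤ [E(K):ℤy_K]` at non-split `p` (Cas24, proof of Thm. 2.1:
`pr₀(κ_∞) = u⁻¹(1 − α⁻¹)·y_K`, `α = −1`) and `p ∤ 𝓛_𝔭(f,K)·[E(K):ℤy_K]` at split `p` (Cas24 Thm. 2.1:
`pr₀(κ'_∞) = 𝓛_𝔭(f,K)·κ_f`)). [cite: Castella2018Erratum, (2.4) (p. 4)] [cite: Washington1997, §13.2] -/
theorem charIdeal_map_le_span_of_generatorSkeleton_of_nakayama [Module.Finite (IwasawaAlgebra p) X]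
    [Module.Finite (IwasawaAlgebra p) S] {M₀ : Type*} [AddCommGroup M₀] [Module (IwasawaAlgebra p) M₀]
    (hX : Module.IsTorsion (IwasawaAlgebra p) X) (loc : S →ₗ[IwasawaAlgebra p] P) (z : S)
    (e : P ≃ₗ[IwasawaAlgebra p] IwasawaAlgebra p)
    (ι : (P ⧸ LinearMap.range loc) →ₗ[IwasawaAlgebra p] X) (hι : Function.Injective ι)
    (pr : S →ₗ[IwasawaAlgebra p] M₀)
    (hker : LinearMap.ker pr ≤
      (IsLocalRing.maximalIdeal (IwasawaAlgebra p)) • (⊤ : Submodule (IwasawaAlgebra p) S))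
    (hz : LinearMap.range pr ≤ Submodule.span (IwasawaAlgebra p) {pr z})
    {w u Q : Λ'} (hw : IsUnit w) (hu : IsUnit u) (hERL : φ (e (loc z)) * w = u * Q) :
    (Literature.NumberTheory.EllipticCurves.Module.charIdeal (IwasawaAlgebra p) X).map φ ≤
      Ideal.span {Q} :=
  charIdeal_map_le_span_of_generatorSkeleton φ hX loc z e ι hι
    (span_singleton_eq_top_of_range_le_span pr hker z hz) hw hu hERL

end EndForm

end GeneratorRoad

/-! ### §3 At the tree's `X_ac^∅(E[p^∞])`: the `∃`-body of the crux shape AT A DATUM -/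

section Datum

variable {W : WeierstrassCurve ℚ} [W.IsElliptic] [W.IsGloballyMinimal] {p : ℕ} [Fact p.Prime]
  {K : Type} [Field K] [NumberField K]

omit [W.IsGloballyMinimal] in
/-- **H3♭ CORE AT A GENERATOR DATUM, from the printed frame + the ROAD G skeleton.** For `W/ℚ`, a
number field `K`, an anticyclotomic-type `κ` with generator `γ`, `ι' : ℂ_p ≃ ℂ`, `w₀` (so
`𝔭 = primeOfEmbeddingDatum p ι' w₀.embedding`), a parametrisation datum `Dt`: GIVEN a frame
`(Ω_K ≠ 0, ‖Ω_p‖ = 1, Q ∈ 𝓞_{ℂ_p}⟦T⟧)` with Castella's interpolation property (Cas18 Thm. 3.1 ∕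
cas-split Thm. 2.11: Castella's `L_𝔭(f)` read in the wide receptacle), torsion-ness of the real module
`X_ac^∅(E_K[p^∞])` (a tree theorem at erratum data: `controlUpperOnTreeAt_of_isErratumField`), and
the skeleton (PT) + (GEN) + (ERL) FOR THAT `Q` (`GeneratorRoad.charIdeal_map_le_span_of_generatorSkeleton`),
the `∃`-body of `P2.IMCDivIntCoreFrameAtErratumData W p` at the datum holds with this very frame.
CONDITIONAL on the skeleton hypotheses (their provenance: JLMS17 (A.7), Cas24 Thm. 2.2 ∕ Cor. 2.3
PREPRINT, `p ∤ [E(K):ℤy_K]` + control); nothing booked; nothing claimed at a divisible datum.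
[cite: Castella2018, Thm. 3.1 and display (3.2) (arXiv:1704.06608 p. 9)]
[cite: Castella2018Erratum, (2.4) (p. 4)] -/
theorem P2.imcDivIntCoreFrameAtDatum_of_generatorSkeleton [NeZero (W.conductorNorm ℤ)]
    (Dt : ModularParametrizationData W (W.conductorNorm ℤ)) (w₀ : InfinitePlace K)
    (κ : ZpExtension K p) (γ : Field.absoluteGaloisGroup K) [Fact (κ.IsTopGenerator γ)]
    (ι' : PadicAlgCl p ≃+* ℂ) {ΩK : ℂ} {Ωp : ℂ_[p]} {Q : PowerSeries 𝓞_ℂ_[p]}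
    (hΩ : ΩK ≠ 0) (hΩp : ‖Ωp‖ = 1)
    (hQ : R1.IsBDPLFunctionInt p ι' (primeOfEmbeddingDatum p ι' w₀.embedding) κ γ Dt.f ΩK Ωp Q)
    (hXt : Module.IsTorsion (IwasawaAlgebra p)
      (XAc (W.baseChange K) p κ (primeOfEmbeddingDatum p ι' w₀.embedding) ∅ γ))
    {S P : Type*} [AddCommGroup S] [Module (IwasawaAlgebra p) S] [AddCommGroup P]
    [Module (IwasawaAlgebra p) P] (loc : S →ₗ[IwasawaAlgebra p] P) (z : S)
    (e : P ≃ₗ[IwasawaAlgebra p] IwasawaAlgebra p)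
    (ι : (P ⧸ LinearMap.range loc) →ₗ[IwasawaAlgebra p]
      XAc (W.baseChange K) p κ (primeOfEmbeddingDatum p ι' w₀.embedding) ∅ γ)
    (hι : Function.Injective ι) (hgen : Submodule.span (IwasawaAlgebra p) {z} = ⊤)
    {w u : PowerSeries 𝓞_ℂ_[p]} (hw : IsUnit w) (hu : IsUnit u)
    (hERL : PowerSeries.map (R1.toCpInt p) (e (loc z)) * w = u * Q) :
    ∃ (ΩK : ℂ) (Ωp : ℂ_[p]) (Q : PowerSeries 𝓞_ℂ_[p]), ΩK ≠ 0 ∧ ‖Ωp‖ = 1 ∧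
      R1.IsBDPLFunctionInt p ι' (primeOfEmbeddingDatum p ι' w₀.embedding) κ γ Dt.f ΩK Ωp Q ∧
      (XAc.charIdeal (W.baseChange K) p κ (primeOfEmbeddingDatum p ι' w₀.embedding) ∅ γ).map
          (PowerSeries.map (R1.toCpInt p)) ≤ Ideal.span {Q} := by
  haveI : Module.Finite (IwasawaAlgebra p)
      (XAc (W.baseChange K) p κ (primeOfEmbeddingDatum p ι' w₀.embedding) ∅ γ) :=
    XAc.module_finite_empty κ _ γ
  exact ⟨ΩK, Ωp, Q, hΩ, hΩp, hQ,
    GeneratorRoad.charIdeal_map_le_span_of_generatorSkeleton (PowerSeries.map (R1.toCpInt p)) hXt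
      loc z e ι hι hgen hw hu hERL⟩

/-- **The ∀-data CORE shape `P2.IMCDivIntCoreFrameAtErratumData W p` (crux 19270's currency, hence
BOTH registered stubs' conclusions, S1 `¬ split → …` and S2 `split → …`) under the ∀-DATA ROAD G
HYPOTHESIS** — binders VERBATIM those of the shape, concluding at each datum a printed frame, torsion
of `X_ac^∅`, and the skeleton for the frame's `Q`. Recorded for completeness ONLY: the hypothesis is
UNREALISTIC class-wide (at every pair there are erratum fields `K` with `p ∣ [E(K):ℤy_K]`, e.g. with
`p ∣ #Ш(E^{d_K})`, where (GEN) fails and (2.4) is the genuine `Λ`-adic Kolyvagin-structure lower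
bound); it makes the logical relation of ROAD G to the registered stubs explicit and nothing more.
CONDITIONAL; nothing booked. [cite: Castella2018Erratum, (2.4) (p. 4)]
[cite: Castella2018, Thm. 3.1 (arXiv:1704.06608 p. 9)] -/
theorem P2.imcDivIntCoreFrameAtErratumData_of_forall_generatorSkeleton
    (hG : ∀ [NeZero (W.conductorNorm ℤ)] (q : ℕ) [Fact q.Prime] (K : Type) [Field K] [NumberField K]
      (Dt : ModularParametrizationData W (W.conductorNorm ℤ))
      (H : HeegnerDatum (W.conductorNorm ℤ) (NumberField.discr K)) (w₀ : InfinitePlace K)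
      (P : (W.baseChange K).toAffine.Point), ErratumHypotheses W p → W.analyticRank = 1 →
      q ≠ p → Mult W q → ¬ W.HasSplitMultiplicativeReductionAtPrime q →
      ¬ p ∣ padicValInt q W.minimalDiscriminantInt → IsErratumField W K q →
      Cas20Standing K p (W.conductorNorm ℤ / p) →
      WeierstrassCurve.Affine.Point.map w₀.embedding.toRatAlgHom P = heegnerPointComplex Dt H →
      ¬ (p : ℤ) ∣ Dt.c → ¬ IsOfFinAddOrder P →
      ∀ (κ : ZpExtension K p), κ.IsAnticyclotomic →
        ∀ (γ : Field.absoluteGaloisGroup K) [Fact (κ.IsTopGenerator γ)] (ι' : PadicAlgCl p ≃+* ℂ)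
          (e : K →+* ℚ_[p]),
          (∀ k : 𝓞 K, k ∈ (primeOfEmbeddingDatum p ι' w₀.embedding).asIdeal ↔ ‖e (k : K)‖ < 1) →
          ∃ (ΩK : ℂ) (Ωp : ℂ_[p]) (Q : PowerSeries 𝓞_ℂ_[p]), ΩK ≠ 0 ∧ ‖Ωp‖ = 1 ∧
            R1.IsBDPLFunctionInt p ι' (primeOfEmbeddingDatum p ι' w₀.embedding) κ γ Dt.f ΩK Ωp Q ∧
            Module.IsTorsion (IwasawaAlgebra p)
              (XAc (W.baseChange K) p κ (primeOfEmbeddingDatum p ι' w₀.embedding) ∅ γ) ∧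
            ∃ (S P : Type) (_ : AddCommGroup S) (_ : Module (IwasawaAlgebra p) S)
              (_ : AddCommGroup P) (_ : Module (IwasawaAlgebra p) P)
              (loc : S →ₗ[IwasawaAlgebra p] P) (z : S) (eP : P ≃ₗ[IwasawaAlgebra p] IwasawaAlgebra p)
              (ι : (P ⧸ LinearMap.range loc) →ₗ[IwasawaAlgebra p]
                XAc (W.baseChange K) p κ (primeOfEmbeddingDatum p ι' w₀.embedding) ∅ γ)
              (w u : PowerSeries 𝓞_ℂ_[p]),
              Function.Injective ι ∧ Submodule.span (IwasawaAlgebra p) {z} = ⊤ ∧ IsUnit w ∧ IsUnit u ∧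
                PowerSeries.map (R1.toCpInt p) (eP (loc z)) * w = u * Q) :
    P2.IMCDivIntCoreFrameAtErratumData W p := by
  intro _ q _ K _ _ Dt H w₀ P hE hr hqp hmq hns hvq hK hCas hP hc hinf κ hκ γ _ ι' e he
  obtain ⟨ΩK, Ωp, Q, hΩ, hΩp, hQ, hXt, S, P', _, _, _, _, loc, z, eP, ι, w, u, hι, hgen, hw, hu,
    hERL⟩ := hG q K Dt H w₀ P hE hr hqp hmq hns hvq hK hCas hP hc hinf κ hκ γ ι' e he
  exact P2.imcDivIntCoreFrameAtDatum_of_generatorSkeleton Dt w₀ κ γ ι' hΩ hΩp hQ hXt loc z eP ι hι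
    hgen hw hu hERL

end Datum

end Summit.BirchSwinnertonDyer.Rank1Residual.X11b
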